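/-
Origin: expansion seat `literature-prover-pub-hodgecm-cf-gaoullmo-0`, handover 2026-08-18T04:18:01Z (`HOME/pub-hodgecm-cf-gaoullmo/GaoUllmoFaceRelations.lean`, md5 1627c974, 190 lines);
landed by the gen-5 packager in gate run 21 as `HodgeCM/Literature/GaoUllmoFaceRelations.lean` (verbatim).
-/
/-
Copyright: pub-hodgecm formalisation cell (harness21, 2026). New file (not vendored).
Origin: HOME/pub-hodgecm-cf-gaoullmo/GaoUllmoFaceRelations.lean (unit pub-hodgecm-cf-gaoullmo, session
literature-prover-pub-hodgecm-cf-gaoullmo-0); suggested target `HodgeCM/Literature/GaoUllmoFaceRelations.lean`.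
-/
import Summits.HodgeConjecture.HodgeCM.Literature.GaoUllmo_2

/-!
# Gao–Ullmo Prop. 5.1 versus FACE relations — the elementary reduction, kernel-proved (GAPS cf-gaoullmo-G2)

`HodgeCM.Literature.GaoUllmo` types Gao–Ullmo, J. Inst. Math. Jussieu 25 (2025), Prop. 5.1 verbatim
(`HodgeCM.GaoUllmo.Proposition51`, KERNEL-PROVED there): for `g ≥ 1` the kernel `N' = ker(rec^*)` of the reflex norm on
characters is generated by ALL quadrilateral relations `ε_I + ε_J − ε_K − ε_L`, `I ∩ J = K ∩ L`, `I ∪ J = K ∪ L`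
(`quadRel g`).  The 2001 write-up rfwf (§6 l.329, ll.287–288; results.tex (GEN)) cites Prop. 5.1 for generation by the
FACE relations `[Φ] + [Φ^{(ππ′)}] − [Φ^{(π)}] − [Φ^{(π′)}]` only, i.e. by the quadrilaterals with `|I △ J| = 2` — the
2-dimensional faces of the cube of CM types.  GAPS.md cf-gaoullmo-G2 records that this inference needs the elementary
lemma "every quadrilateral relation is a `ℤ`-combination of 2-face relations", which Gao–Ullmo do not state.  This file
PROVES that lemma (`quad_mem_faceRel`, `quadRel_eq_faceRel`) and hence, with `Proposition51_holds`,
`Nprime_eq_faceRel : 0 < g → Nprime g = faceRel g` — so rfwf's (GEN) sentence is PRINT (GU Prop. 5.1) + KERNEL.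
Nothing is posited; no statement of `GaoUllmo.lean` is touched.  (The package itself never needed this: it proves
generation by face relations directly, `HodgeCM.Prior.AllgGroup.RfwfAllgGroup.gfaces_generate`.)

Proof: write `d_a(A) := ε_{A ⊔ a} − ε_A`; a 2-face relation is `d_a(C ⊔ b) − d_a(C)`, so `d_a(A) − d_a(B)` is a sum of
2-face relations for all `A, B ∌ a` (`dStep_sub_dStep_mem`); a quadrilateral relation with `C = I ∩ J ⊆ I, K ⊆ U = I ∪ J`
is `S(I) − S(K)` for `S(I) := ε_I + ε_{C ∪ (U ∖ I)}`, and `S(C ⊔ T ⊔ b) − S(C ⊔ T) = d_b(C ⊔ T) − d_b(C ∪ (U ∖ (C ⊔ T ⊔ b)))`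
telescopes (`sFun_sub_mem`).
-/

noncomputable section

attribute [local instance] Classical.propDecidable

namespace HodgeCM
namespace GaoUllmo

section FaceRelations

variable (g : ℕ)

/-- The **2-face relations** of the cube of subsets of `{1,…,g}` (rfwf's face relations `r(Φ; π, π′)`):
`ε_C + ε_{C ⊔ {a,b}} − ε_{C ⊔ {a}} − ε_{C ⊔ {b}}` for `a ≠ b` outside `C`, and the subgroup of `X^*` they generate. -/
def faceRel : Submodule ℤ (XStar g) :=
  Submodule.span ℤ {x | ∃ (C : Finset (Fin g)) (a b : Fin g), a ∉ C ∧ b ∉ C ∧ a ≠ b ∧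
    x = eps g C + eps g (insert a (insert b C)) - eps g (insert a C) - eps g (insert b C)}

/-- Every 2-face relation is one of Gao–Ullmo's quadrilateral relations. -/
theorem faceRel_le_quadRel : faceRel g ≤ quadRel g := by
  apply Submodule.span_le.mpr
  rintro _ ⟨C, a, b, ha, hb, hab, rfl⟩
  refine Submodule.subset_span ⟨C, insert a (insert b C), insert a C, insert b C, ?_, ?_, rfl⟩
  · ext x
    simp only [Finset.mem_inter, Finset.mem_insert]
    constructor
    · rintro ⟨hx, _⟩; exact ⟨Or.inr hx, Or.inr hx⟩
    · rintro ⟨h1 | h1, h2 | h2⟩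
      · exact absurd (h1.symm.trans h2) hab
      · exact absurd (h1 ▸ h2) ha
      · exact absurd (h2 ▸ h1) hb
      · exact ⟨h1, Or.inr (Or.inr h1)⟩
  · ext x
    simp only [Finset.mem_union, Finset.mem_insert]
    tauto

/-- `d_a(A) := ε_{A ⊔ a} − ε_A`. -/
def dStep (a : Fin g) (A : Finset (Fin g)) : XStar g := eps g (insert a A) - eps g A

/-- `d_a(A) − d_a(∅)` is a sum of 2-face relations (`a ∉ A`). -/
theorem dStep_sub_dStep_empty_mem (a : Fin g) (A : Finset (Fin g)) (ha : a ∉ A) :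
    dStep g a A - dStep g a ∅ ∈ faceRel g := by
  induction A using Finset.induction_on with
  | empty => simp
  | insert b A hb ih =>
    have haA : a ∉ A := fun h => ha (Finset.mem_insert_of_mem h)
    have hab : a ≠ b := fun h => ha (h ▸ Finset.mem_insert_self b A)
    have hgen : dStep g a (insert b A) - dStep g a A ∈ faceRel g := by
      refine Submodule.subset_span ⟨A, a, b, haA, hb, hab, ?_⟩
      simp only [dStep]
      abel
    have := Submodule.add_mem _ hgen (ih haA)
    simpa [dStep] using this

/-- `d_a(A) − d_a(B)` is a sum of 2-face relations (`a ∉ A`, `a ∉ B`). -/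
theorem dStep_sub_dStep_mem (a : Fin g) (A B : Finset (Fin g)) (ha : a ∉ A) (hb : a ∉ B) :
    dStep g a A - dStep g a B ∈ faceRel g := by
  have := Submodule.sub_mem _ (dStep_sub_dStep_empty_mem g a A ha) (dStep_sub_dStep_empty_mem g a B hb)
  simpa using this

/-- `S(I) := ε_I + ε_{C ∪ (U ∖ I)}` — for `I ∩ J = C`, `I ∪ J = U` one has `J = C ∪ (U ∖ I)`. -/
def sFun (C U I : Finset (Fin g)) : XStar g := eps g I + eps g (C ∪ (U \ I))

/-- `S(C ⊔ T) − S(C)` is a sum of 2-face relations for `T ⊆ U ∖ C`. -/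
theorem sFun_sub_mem (C U : Finset (Fin g)) (T : Finset (Fin g)) (hT : T ⊆ U \ C) :
    sFun g C U (C ∪ T) - sFun g C U C ∈ faceRel g := by
  induction T using Finset.induction_on with
  | empty => simp
  | insert b T hbT ih =>
    have hT' : T ⊆ U \ C := fun x hx => hT (Finset.mem_insert_of_mem hx)
    have hbUC : b ∈ U \ C := hT (Finset.mem_insert_self b T)
    have hbU : b ∈ U := (Finset.mem_sdiff.mp hbUC).1
    have hbC : b ∉ C := (Finset.mem_sdiff.mp hbUC).2
    -- the one-step difference is `d_b(C ∪ T) − d_b(B)` with `B = C ∪ (U \ (C ∪ insert b T))`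
    have hbA : b ∉ C ∪ T := by simp [hbC, hbT]
    have hbB : b ∉ C ∪ (U \ (C ∪ insert b T)) := by simp [hbC]
    have hins : C ∪ insert b T = insert b (C ∪ T) := by
      ext x; simp only [Finset.mem_union, Finset.mem_insert]; tauto
    have hcompl : C ∪ (U \ (C ∪ T)) = insert b (C ∪ (U \ (C ∪ insert b T))) := by
      ext x
      simp only [Finset.mem_union, Finset.mem_sdiff, Finset.mem_insert]
      constructor
      · rintro (hx | ⟨hxU, hx⟩)
        · exact Or.inr (Or.inl hx)
        · by_cases hxb : x = b
          · exact Or.inl hxb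
          · exact Or.inr (Or.inr ⟨hxU, fun h => h.elim (fun h => hx (Or.inl h)) fun h =>
              h.elim (fun h => hxb h) fun h => hx (Or.inr h)⟩)
      · rintro (rfl | hx | ⟨hxU, hx⟩)
        · exact Or.inr ⟨hbU, fun h => h.elim hbC hbT⟩
        · exact Or.inl hx
        · exact Or.inr ⟨hxU, fun h => hx (h.elim Or.inl fun h => Or.inr (Or.inr h))⟩
    have hstep : sFun g C U (C ∪ insert b T) - sFun g C U (C ∪ T) =
        dStep g b (C ∪ T) - dStep g b (C ∪ (U \ (C ∪ insert b T))) := by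
      simp only [sFun, dStep, hins, hcompl]
      abel
    have h1 := dStep_sub_dStep_mem g b _ _ hbA hbB
    rw [← hstep] at h1
    have := Submodule.add_mem _ h1 (ih hT')
    simpa using this

/-- **Every quadrilateral relation is a `ℤ`-combination of 2-face relations.** -/
theorem quad_mem_faceRel (I J K L : Finset (Fin g)) (h1 : I ∩ J = K ∩ L) (h2 : I ∪ J = K ∪ L) :
    eps g I + eps g J - eps g K - eps g L ∈ faceRel g := by
  have e1 : ∀ x, (x ∈ I ∧ x ∈ J ↔ x ∈ K ∧ x ∈ L) := fun x => by
    simpa only [Finset.mem_inter] using Finset.ext_iff.mp h1 x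
  have e2 : ∀ x, (x ∈ I ∨ x ∈ J ↔ x ∈ K ∨ x ∈ L) := fun x => by
    simpa only [Finset.mem_union] using Finset.ext_iff.mp h2 x
  have hJ : J = (I ∩ J) ∪ ((I ∪ J) \ I) := by
    ext x; simp only [Finset.mem_union, Finset.mem_inter, Finset.mem_sdiff]; tauto
  have hL : L = (I ∩ J) ∪ ((I ∪ J) \ K) := by
    ext x
    have h1x := e1 x
    have h2x := e2 x
    simp only [Finset.mem_union, Finset.mem_inter, Finset.mem_sdiff]
    tauto
  have hI : I = (I ∩ J) ∪ (I \ (I ∩ J)) := by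
    ext x; simp only [Finset.mem_union, Finset.mem_inter, Finset.mem_sdiff]; tauto
  have hK : K = (I ∩ J) ∪ (K \ (I ∩ J)) := by
    ext x
    have h1x := e1 x
    simp only [Finset.mem_union, Finset.mem_inter, Finset.mem_sdiff]
    tauto
  have hIT : I \ (I ∩ J) ⊆ (I ∪ J) \ (I ∩ J) := by
    intro x hx
    simp only [Finset.mem_sdiff, Finset.mem_union, Finset.mem_inter] at hx ⊢
    tauto
  have hKT : K \ (I ∩ J) ⊆ (I ∪ J) \ (I ∩ J) := by
    intro x hx
    have h1x := e1 x
    have h2x := e2 x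
    simp only [Finset.mem_sdiff, Finset.mem_union, Finset.mem_inter] at hx ⊢
    tauto
  have hA := sFun_sub_mem g (I ∩ J) (I ∪ J) (I \ (I ∩ J)) hIT
  have hB := sFun_sub_mem g (I ∩ J) (I ∪ J) (K \ (I ∩ J)) hKT
  rw [← hI] at hA
  rw [← hK] at hB
  have hEq : eps g I + eps g J - eps g K - eps g L =
      (sFun g (I ∩ J) (I ∪ J) I - sFun g (I ∩ J) (I ∪ J) (I ∩ J)) -
        (sFun g (I ∩ J) (I ∪ J) K - sFun g (I ∩ J) (I ∪ J) (I ∩ J)) := by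
    rw [sFun, sFun, sFun, ← hJ, ← hL]
    abel
  rw [hEq]
  exact Submodule.sub_mem _ hA hB

/-- **Gao–Ullmo's quadrilateral relations and rfwf's 2-face relations generate the same subgroup of `X^*`.** -/
theorem quadRel_eq_faceRel : quadRel g = faceRel g := by
  refine le_antisymm ?_ (faceRel_le_quadRel g)
  apply Submodule.span_le.mpr
  rintro _ ⟨I, J, K, L, h1, h2, rfl⟩
  exact quad_mem_faceRel g I J K L h1 h2

/-- **Prop. 5.1 in rfwf's form** (GAPS cf-gaoullmo-G2 closed, PRINT + KERNEL): for `g ≥ 1`, `N' = ker(rec^*)` is generated by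
the 2-face relations. -/
theorem Nprime_eq_faceRel (hg : 0 < g) : Nprime g = faceRel g := by
  rw [← quadRel_eq_faceRel, Proposition51_holds g hg]

end FaceRelations

end GaoUllmo
end HodgeCM

end
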